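import Summits.BirchSwinnertonDyer.BirchSwinnertonDyer.Theorems.ByReductionTypeAtTwoMultTowerNS2TowerCosets
import Mathlib.FieldTheory.Fixed
import HarnessLib

/-!
# Route `ByReductionTypeAtTwo`, crux `MultUpperHalfAtTwo` (item stmt-BirchSwinnertonDyer-19922), TOWER road, the
# «ONE BIT AT A NON-SPLIT 2» rows: KERNEL BRICK 16a — algebra of the twisted Tate module over the local cyclotomic
# `ℤ₂`-tower: flips, `Γ`-stability of the fixed fields `K̄^{H ∩ Stab(t)}`, orbit products, and the two Hilbert 90's

HONEST FRAMING (cell `bsd-2adic`, run/shared/lean/pub/bsd-2adic/, seat `bsd-2adic-tower-1` GEN 9, HUMAN RULINGS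
D-0036 / D-0054 / D-0074): TOOL theorems only (no definition, no named fact, no `sorry`); closes nothing by itself;
nothing booked; BSD is not proved by any of this. Module M6 (steps S3–S6) of the KERNELISATION of the MEMO binder
`MultTowerNS2.localTowerKerTwoTorsion_le_two_nonsplitTwo_of_tateUnit` (scope memo HOME/tower/SCOPE-hNS2one-kernel-GEN8.md).
Setting (`v ∋ 2`, `K = ℚ_v`, `Γ = Gal(K̄/K)` acting on `K̄`): an element `t ∈ K̄` with `σ t = ±t` for all `σ` (the
square root `√γ` of the twisted Tate uniformisation), a normal subgroup `N ≤ Γ` (a local layer subgroup `H_m`), the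
subgroup `N ∩ Stab(t)` and its fixed field `K̄^{N ∩ Stab(t)}` (the compositum `F_m K(t)`), a «flip» `τ₀` (`τ₀ t = −t`).

* `smul_mem_fixedField_inf_stabilizer` — `K̄^{N ∩ Stab(t)}` is `Γ`-stable; `flip_smul_eq` — two flips of `N` agree on it;
* `prod_smul_*` — the orbit products `N_R(w) = ∏_{i<2^R} g^i w` (multiplicativity, shift by `g`, `N_{R+1} = N_R · g^{2^R}N_R`);
* `eq_flip_smul_div_of_flip_smul_mul_eq_one` — **quadratic Hilbert 90, explicit**: `τ₀z · z = 1 ⇒ z = τ₀(z₀)/z₀` with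
  `z₀ = 1 + z⁻¹` or `z₀ = t`;
* `exists_eq_smul_div_of_prod_smul_eq_one` — **cyclic Hilbert 90 for `⟨g⟩` on `K̄^{H_{n+R} ∩ Stab(t)}`**: `N_R(u) = 1 ⇒
  u = g(y)/y` (Artin's independence of the characters `x ↦ g^i x`, Mathlib `linearIndependent_monoidHom`; the Lagrange
  resolvent `θ = ∑ (∏_{j<i} g^j u) g^i b` has `u · gθ = θ`).

References: J. Neukirch, *ANT* IV (3.5) (Hilbert 90), E. Artin (independence of characters); scope memo S4/S6.
-/

set_option autoImplicit false
-- the Theorems namespace of this sub repeats the summit name by design (D-0017 nested layout: Summit.<S>.<Sub>)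
set_option linter.dupNamespace false

noncomputable section

open scoped Classical IntermediateField

namespace Summit.BirchSwinnertonDyer.BirchSwinnertonDyer.Theorems.MultTowerNS2

open NumberField IsDedekindDomain Field PadicInt Literature.NumberTheory.EllipticCurves
  Literature.NumberTheory.GaloisRepresentations

variable {K : Type*} [Field K]

/-! ### Flips and the `Γ`-stability of `K̄^{N ∩ Stab(t)}` -/

/-- If `σ t = ±t` then `σ⁻¹ t = σ t` (both signs square to `1`). [folklore] -/
theorem inv_smul_eq_smul_of_smul_eq_or {t : AlgebraicClosure K} {σ : absoluteGaloisGroup K}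
    (h : σ • t = t ∨ σ • t = -t) : σ⁻¹ • t = σ • t := by
  rcases h with h | h
  · rw [h]; nth_rw 1 [← h]; rw [inv_smul_smul]
  · rw [h]
    have h' : σ⁻¹ • (σ • t) = t := inv_smul_smul σ t
    rw [h, smul_neg, neg_eq_iff_eq_neg] at h'
    exact h'

/-- A conjugate `σ⁻¹ h σ` of an element `h` fixing `t` fixes `t` (when every element maps `t` to `±t`). [folklore] -/
theorem conj_smul_eq_of_smul_eq {t : AlgebraicClosure K} (ht : ∀ σ : absoluteGaloisGroup K, σ • t = t ∨ σ • t = -t)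
    {h : absoluteGaloisGroup K} (hh : h • t = t) (σ : absoluteGaloisGroup K) : (σ⁻¹ * h * σ) • t = t := by
  rw [mul_smul, mul_smul]
  rcases ht σ with hs | hs
  · rw [hs, hh, inv_smul_eq_smul_of_smul_eq_or (ht σ), hs]
  · rw [hs, smul_neg, hh, smul_neg, inv_smul_eq_smul_of_smul_eq_or (ht σ), hs, neg_neg]

/-- **`K̄^{N ∩ Stab(t)}` is `Γ`-stable** for `N ⊴ Γ` and `σ t = ±t` for all `σ`: if `x` is fixed by every element of
`N` fixing `t`, so is `σ x`. [folklore] -/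
theorem smul_mem_of_forall_mem_smul_eq {t : AlgebraicClosure K}
    (ht : ∀ σ : absoluteGaloisGroup K, σ • t = t ∨ σ • t = -t) (N : Subgroup (absoluteGaloisGroup K)) [N.Normal]
    {x : AlgebraicClosure K} (hx : ∀ h ∈ N, h • t = t → h • x = x) (σ : absoluteGaloisGroup K) :
    ∀ h ∈ N, h • t = t → h • (σ • x) = σ • x := by
  intro h hh hht
  have hc : σ⁻¹ * h * σ ∈ N := by
    have := Subgroup.Normal.conj_mem inferInstance h hh σ⁻¹
    rwa [inv_inv] at this
  have h1 := hx _ hc (conj_smul_eq_of_smul_eq ht hht σ)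
  rw [mul_smul, mul_smul, inv_smul_eq_iff] at h1
  exact h1

/-- **Two flips of `N` agree on `K̄^{N ∩ Stab(t)}`**: if `τ₀, τ ∈ N` both send `t ↦ −t` and `x` is fixed by
`N ∩ Stab(t)`, then `τ x = τ₀ x`. [folklore] -/
theorem flip_smul_eq {t : AlgebraicClosure K} {N : Subgroup (absoluteGaloisGroup K)} {τ₀ τ : absoluteGaloisGroup K}
    (hτ₀ : τ₀ ∈ N) (hτ₀t : τ₀ • t = -t) (hτ : τ ∈ N) (hτt : τ • t = -t) {x : AlgebraicClosure K}
    (hx : ∀ h ∈ N, h • t = t → h • x = x) : τ • x = τ₀ • x := by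
  have h1 : (τ₀⁻¹ * τ) • t = t := by
    rw [mul_smul, hτt, smul_neg, inv_smul_eq_smul_of_smul_eq_or (Or.inr hτ₀t), hτ₀t, neg_neg]
  have h2 := hx _ (N.mul_mem (N.inv_mem hτ₀) hτ) h1
  rw [mul_smul, inv_smul_eq_iff] at h2
  exact h2

/-- **`τ₀ (σ x) = σ (τ₀ x)`** for `σ` fixing `t`, a flip `τ₀ ∈ N ⊴ Γ` and `x ∈ K̄^{N ∩ Stab(t)}` (the conjugate
`σ⁻¹ τ₀ σ` is again a flip of `N`). [folklore] -/
theorem flip_smul_smul_comm {t : AlgebraicClosure K} (ht : ∀ σ : absoluteGaloisGroup K, σ • t = t ∨ σ • t = -t)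
    {N : Subgroup (absoluteGaloisGroup K)} [N.Normal] {τ₀ : absoluteGaloisGroup K} (hτ₀ : τ₀ ∈ N) (hτ₀t : τ₀ • t = -t)
    {σ : absoluteGaloisGroup K} (hσ : σ • t = t) {x : AlgebraicClosure K} (hx : ∀ h ∈ N, h • t = t → h • x = x) :
    τ₀ • (σ • x) = σ • (τ₀ • x) := by
  have hc : σ⁻¹ * τ₀ * σ ∈ N := by
    have := Subgroup.Normal.conj_mem inferInstance τ₀ hτ₀ σ⁻¹
    rwa [inv_inv] at this
  have hct : (σ⁻¹ * τ₀ * σ) • t = -t := by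
    rw [mul_smul, mul_smul, hσ, hτ₀t, smul_neg, inv_smul_eq_smul_of_smul_eq_or (ht σ), hσ]
  have h := flip_smul_eq hτ₀ hτ₀t hc hct hx
  rw [mul_smul, mul_smul, inv_smul_eq_iff] at h
  exact h

/-- `τ₀² x = x` for a flip `τ₀ ∈ N` and `x ∈ K̄^{N ∩ Stab(t)}`. [folklore] -/
theorem flip_smul_flip_smul {t : AlgebraicClosure K} {N : Subgroup (absoluteGaloisGroup K)} {τ₀ : absoluteGaloisGroup K}
    (hτ₀ : τ₀ ∈ N) (hτ₀t : τ₀ • t = -t) {x : AlgebraicClosure K} (hx : ∀ h ∈ N, h • t = t → h • x = x) :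
    τ₀ • (τ₀ • x) = x := by
  rw [← mul_smul]
  exact hx _ (N.mul_mem hτ₀ hτ₀) (by rw [mul_smul, hτ₀t, smul_neg, hτ₀t, neg_neg])

/-- A smaller subgroup fixes more: `x ∈ K̄^{N ∩ Stab(t)}` and `N' ≤ N` give `x ∈ K̄^{N' ∩ Stab(t)}`. [folklore] -/
theorem forall_mem_smul_eq_of_le {t : AlgebraicClosure K} {N N' : Subgroup (absoluteGaloisGroup K)} (hle : N' ≤ N)
    {x : AlgebraicClosure K} (hx : ∀ h ∈ N, h • t = t → h • x = x) : ∀ h ∈ N', h • t = t → h • x = x :=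
  fun h hh hht ↦ hx h (hle hh) hht

/-! ### Orbit products `N_R(w) = ∏_{i<2^R} g^i w` -/

/-- `N(w₁ w₂) = N(w₁) N(w₂)`. [folklore] -/
theorem prod_smul_mul (g : absoluteGaloisGroup K) (m : ℕ) (w₁ w₂ : AlgebraicClosure K) :
    (∏ i ∈ Finset.range m, (g ^ i) • (w₁ * w₂)) =
      (∏ i ∈ Finset.range m, (g ^ i) • w₁) * ∏ i ∈ Finset.range m, (g ^ i) • w₂ := by
  rw [← Finset.prod_mul_distrib]
  exact Finset.prod_congr rfl fun i _ ↦ smul_mul' _ _ _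

/-- `N(w⁻¹) = N(w)⁻¹`. [folklore] -/
theorem prod_smul_inv (g : absoluteGaloisGroup K) (m : ℕ) (w : AlgebraicClosure K) :
    (∏ i ∈ Finset.range m, (g ^ i) • w⁻¹) = (∏ i ∈ Finset.range m, (g ^ i) • w)⁻¹ := by
  rw [← Finset.prod_inv_distrib]
  exact Finset.prod_congr rfl fun i _ ↦ smul_inv'' _ _

/-- `N_m(g w) = N_m(w)` when `g^m w = w`. [folklore] -/
theorem prod_smul_smul_eq (g : absoluteGaloisGroup K) (m : ℕ) {w : AlgebraicClosure K} (hw : (g ^ m) • w = w) :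
    (∏ i ∈ Finset.range m, (g ^ i) • (g • w)) = ∏ i ∈ Finset.range m, (g ^ i) • w := by
  have h : ∀ i, (g ^ i) • (g • w) = (g ^ (i + 1)) • w := fun i ↦ by rw [← mul_smul, ← pow_succ]
  simp_rw [h]
  by_cases hw0 : w = 0
  · simp [hw0]
  -- `(∏_{i<m} g^{i+1} w) · g^0 w = ∏_{i<m+1} g^i w = (∏_{i<m} g^i w) · g^m w`
  have h1 := Finset.prod_range_succ' (fun i ↦ (g ^ i) • w) m
  rw [Finset.prod_range_succ, hw, pow_zero, one_smul] at h1
  exact mul_right_cancel₀ hw0 h1.symm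

/-- `g^m N_m(w) = N_m(w)` when `g^m w = w`. [folklore] -/
theorem pow_smul_prod_smul_eq (g : absoluteGaloisGroup K) (m : ℕ) {w : AlgebraicClosure K} (hw : (g ^ m) • w = w) :
    (g ^ m) • (∏ i ∈ Finset.range m, (g ^ i) • w) = ∏ i ∈ Finset.range m, (g ^ i) • w := by
  rw [Finset.smul_prod']
  refine Finset.prod_congr rfl fun i _ ↦ ?_
  rw [← mul_smul, ← pow_add, add_comm, pow_add, mul_smul, hw]

/-- `N_{2m}(w) = N_m(w) · g^m N_m(w)` (splitting the range `[0, 2m)`). [folklore] -/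
theorem prod_smul_range_two_mul (g : absoluteGaloisGroup K) (m : ℕ) (w : AlgebraicClosure K) :
    (∏ i ∈ Finset.range (2 * m), (g ^ i) • w) =
      (∏ i ∈ Finset.range m, (g ^ i) • w) * (g ^ m) • ∏ i ∈ Finset.range m, (g ^ i) • w := by
  rw [two_mul, Finset.prod_range_add, Finset.smul_prod']
  congr 1
  exact Finset.prod_congr rfl fun i _ ↦ by rw [pow_add, mul_smul]

/-- `N_m` of a `g`-fixed element is its `m`-th power. [folklore] -/
theorem prod_smul_eq_pow_of_smul_eq (g : absoluteGaloisGroup K) (m : ℕ) {w : AlgebraicClosure K} (hw : g • w = w) :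
    (∏ i ∈ Finset.range m, (g ^ i) • w) = w ^ m := by
  have h : ∀ i, (g ^ i) • w = w := fun i ↦ by
    induction i with
    | zero => rw [pow_zero, one_smul]
    | succ i ih => rw [pow_succ, mul_smul, hw, ih]
  simp_rw [h]
  rw [Finset.prod_const, Finset.card_range]

/-! ### Quadratic Hilbert 90, explicit -/

/-- **Quadratic Hilbert 90, explicit.** If `τ₀ z · z = 1` (`z ≠ 0`) then `z = τ₀(z₀)/z₀` with `z₀ = 1 + z⁻¹` (when
`1 + z⁻¹ ≠ 0`) — and when `z = −1`, `z = τ₀(t)/t` for any `t ≠ 0` with `τ₀ t = −t`. [cite: NeukirchANT1999, Ch. IV (3.5)] -/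
theorem eq_flip_smul_div_of_flip_smul_mul_eq_one (τ₀ : absoluteGaloisGroup K) {z : AlgebraicClosure K} (hz : z ≠ 0)
    (hz1 : τ₀ • z * z = 1) :
    (1 + z⁻¹ ≠ 0 → z = τ₀ • (1 + z⁻¹) / (1 + z⁻¹)) ∧
      (1 + z⁻¹ = 0 → ∀ t : AlgebraicClosure K, t ≠ 0 → τ₀ • t = -t → z = τ₀ • t / t) := by
  have hτz : τ₀ • z = z⁻¹ := eq_inv_of_mul_eq_one_left hz1
  constructor
  · intro h0
    rw [smul_add, smul_one, smul_inv'', hτz, inv_inv, eq_div_iff h0]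
    field_simp
    ring
  · intro h0 t ht0 hτt
    have hz' : z = -1 := by
      have h1 : z * (1 + z⁻¹) = 0 := by rw [h0, mul_zero]
      rw [mul_add, mul_one, mul_inv_cancel₀ hz] at h1
      linear_combination h1
    rw [hz', hτt, neg_div, div_self ht0]

/-! ### Cyclic Hilbert 90 for `⟨g⟩` acting on `K̄^{H_{n+R} ∩ Stab(t)}` -/

variable {κ : ZpExtension ℚ 2}

/-- **Cyclic Hilbert 90 for the local layer.** `κ` the cyclotomic `ℤ₂`-extension, `v ∋ 2`, `g ∈ Γ_{ℚ_v}` with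
`κ(res g) = 2^n u_g` (`u_g` a unit) fixing `t` (`σ t = ±t` for all `σ`), `M = K̄_v^{H_{n+R} ∩ Stab(t)}`: the group
`⟨g⟩` acts on `M` through a cyclic group of order `2^R`, and an element `u ∈ M` with `∏_{i<2^R} g^i u = 1` is `g(y)/y`
for some `y ∈ Mˣ`. Proof: the `2^R` characters `x ↦ g^i x` of `Mˣ` are distinct (`g^i ∉ H_{n+R} = Gal(K̄/F_{n+R})`
for `0 < i < 2^R`, BRICK 15), hence linearly independent (Artin; Mathlib `linearIndependent_monoidHom`), so some
Lagrange resolvent `θ = ∑_i (∏_{j<i} g^j u) g^i b` is non-zero; it satisfies `u · gθ = θ`, and `y = θ⁻¹`.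
[cite: NeukirchANT1999, Ch. IV (3.5)] -/
theorem exists_eq_smul_div_of_prod_smul_eq_one (v : HeightOneSpectrum (𝓞 ℚ)) (n R : ℕ)
    {g : absoluteGaloisGroup (v.adicCompletion ℚ)} {ug : ℤ_[2]ˣ}
    (hug : ((κ (resGal (K := ℚ) (v.adicCompletion ℚ) g)).toAdd : ℤ_[2]) = 2 ^ n * (ug : ℤ_[2]))
    {t : AlgebraicClosure (v.adicCompletion ℚ)}
    (ht : ∀ σ : absoluteGaloisGroup (v.adicCompletion ℚ), σ • t = t ∨ σ • t = -t) (hgt : g • t = t)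
    {u : AlgebraicClosure (v.adicCompletion ℚ)}
    (hu : ∀ h ∈ localSubgroup (κ.layerSubgroup (n + R)) (v.adicCompletion ℚ), h • t = t → h • u = u)
    (hN : (∏ i ∈ Finset.range (2 ^ R), (g ^ i) • u) = 1) :
    ∃ y : AlgebraicClosure (v.adicCompletion ℚ), y ≠ 0 ∧
      (∀ h ∈ localSubgroup (κ.layerSubgroup (n + R)) (v.adicCompletion ℚ), h • t = t → h • y = y) ∧
      u = g • y / y := by
  -- the field `M = K̄^{H_{n+R} ∩ Stab(t)}` and the subfield `F_{n+R} = K̄^{H_{n+R}}`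
  set Hm := localSubgroup (κ.layerSubgroup (n + R)) (v.adicCompletion ℚ) with hHm
  haveI hnormal : Hm.Normal := by rw [hHm, localSubgroup_eq_comap]; exact Subgroup.Normal.comap inferInstance _
  let M : IntermediateField (v.adicCompletion ℚ) (AlgebraicClosure (v.adicCompletion ℚ)) :=
    IntermediateField.fixedField (Hm ⊓ MulAction.stabilizer (absoluteGaloisGroup (v.adicCompletion ℚ)) t)
  have hmemM : ∀ x, x ∈ M ↔ ∀ h ∈ Hm, h • t = t → h • x = x := by
    intro x
    rw [IntermediateField.mem_fixedField_iff]
    constructor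
    · intro hx h hh hht
      have hmem : h ∈ Hm ⊓ MulAction.stabilizer (absoluteGaloisGroup (v.adicCompletion ℚ)) t :=
        Subgroup.mem_inf.mpr ⟨hh, MulAction.mem_stabilizer_iff.mpr hht⟩
      exact hx h hmem
    · intro hx f hf
      let f' : absoluteGaloisGroup (v.adicCompletion ℚ) := f
      have hf' : f' ∈ Hm ⊓ MulAction.stabilizer (absoluteGaloisGroup (v.adicCompletion ℚ)) t := hf
      obtain ⟨hf1, hf2⟩ := Subgroup.mem_inf.mp hf'
      exact hx f' hf1 (MulAction.mem_stabilizer_iff.mp hf2)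
  have hstab : ∀ σ : absoluteGaloisGroup (v.adicCompletion ℚ), ∀ x ∈ M, σ • x ∈ M := fun σ x hx ↦
    (hmemM _).mpr (smul_mem_of_forall_mem_smul_eq ht Hm ((hmemM x).mp hx) σ)
  have hgit : ∀ i : ℕ, (g ^ i) • t = t := fun i ↦ by
    induction i with
    | zero => rw [pow_zero, one_smul]
    | succ i ih => rw [pow_succ, mul_smul, hgt, ih]
  have hgi : ∀ i : ℕ, g ^ i ∈ Hm ↔ 2 ^ R ∣ i := pow_mem_localSubgroup_layerSubgroup_iff (κ := κ) v n R hug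
  have hgRM : ∀ x ∈ M, (g ^ 2 ^ R) • x = x := fun x hx ↦ (hmemM x).mp hx _ ((hgi _).mpr dvd_rfl) (hgit _)
  have huM : u ∈ M := (hmemM u).mpr hu
  have hopen : IsOpen (Hm : Set (absoluteGaloisGroup (v.adicCompletion ℚ))) :=
    isOpen_localSubgroup _ (κ.isOpen_layerSubgroup (n + R)) _
  have hFM : IntermediateField.fixedField Hm ≤ M := IntermediateField.fixedField_le inf_le_left
  -- `u ≠ 0`
  have hR0 : 0 < 2 ^ R := pow_pos two_pos R
  have hu0 : u ≠ 0 := by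
    intro h0
    have hz : (∏ i ∈ Finset.range (2 ^ R), (g ^ i) • u) = 0 :=
      Finset.prod_eq_zero (Finset.mem_range.mpr hR0) (by rw [h0, smul_zero])
    rw [hz] at hN
    exact zero_ne_one hN
  -- (`CharZero ℚ_v` from here on; no term mentioning `localSubgroup` is written after this point)
  haveI : CharZero (v.adicCompletion ℚ) :=
    charZero_of_injective_algebraMap (algebraMap ℚ (v.adicCompletion ℚ)).injective
  have hfix := fixingSubgroup_fixedField_of_isOpen _ hopen
  have hHfix := fun σ ↦ SetLike.ext_iff.mp hfix σ
  -- the characters `x ↦ g^i x` of `M`, `i < 2^R`, are distinct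
  let χ : Fin (2 ^ R) → (M →* AlgebraicClosure (v.adicCompletion ℚ)) := fun i ↦
    { toFun := fun x ↦ (g ^ (i : ℕ)) • (x : AlgebraicClosure (v.adicCompletion ℚ))
      map_one' := by simp
      map_mul' := fun x y ↦ by
        rw [IntermediateField.coe_mul]
        exact smul_mul' _ _ _ }
  have hχapp : ∀ (i : Fin (2 ^ R)) (x : M), χ i x = (g ^ (i : ℕ)) • (x : AlgebraicClosure (v.adicCompletion ℚ)) :=
    fun _ _ ↦ rfl
  have key : ∀ i i' : Fin (2 ^ R), (i : ℕ) < i' → χ i = χ i' → False := by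
    intro i i' hlt heq
    set d : ℕ := (i' : ℕ) - i with hd
    have hd0 : 0 < d := by omega
    have hdlt : d < 2 ^ R := by omega
    have hgd : g ^ d ∉ Hm := by
      rw [hgi]
      intro hdvd
      exact absurd (Nat.le_of_dvd hd0 hdvd) (by omega)
    -- some `b ∈ F_{n+R}` is moved by `g^d`
    have hnot : ¬ ∀ b : IntermediateField.fixedField Hm,
        (g ^ d) • (b : AlgebraicClosure (v.adicCompletion ℚ)) = b := by
      intro hall
      exact hgd ((hHfix (g ^ d)).mp ((mem_fixingSubgroup_iff_forall_smul (IntermediateField.fixedField Hm) (g ^ d)).mpr hall))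
    push Not at hnot
    obtain ⟨⟨b, hb⟩, hgb⟩ := hnot
    have h1 := DFunLike.congr_fun heq ⟨b, hFM hb⟩
    rw [hχapp, hχapp] at h1
    change (g ^ (i : ℕ)) • b = (g ^ (i' : ℕ)) • b at h1
    rw [show (i' : ℕ) = (i : ℕ) + d by omega, pow_add, mul_smul] at h1
    exact hgb (smul_left_cancel (g ^ (i : ℕ)) h1.symm)
  have hχinj : Function.Injective χ := by
    intro i i' h
    rcases lt_trichotomy (i : ℕ) i' with hlt | heq | hgt
    · exact (key i i' hlt h).elim
    · exact Fin.ext heq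
    · exact (key i' i hgt h.symm).elim
  -- Artin: the characters are linearly independent, so some Lagrange resolvent is non-zero
  have hli := (linearIndependent_monoidHom M (AlgebraicClosure (v.adicCompletion ℚ))).comp χ hχinj
  let c : ℕ → AlgebraicClosure (v.adicCompletion ℚ) := fun i ↦ ∏ j ∈ Finset.range i, (g ^ j) • u
  have hc0 : c 0 = 1 := Finset.prod_range_zero _
  have hcN : c (2 ^ R) = 1 := hN
  obtain ⟨b, hb⟩ : ∃ b : M, (∑ i : Fin (2 ^ R), c i * (g ^ (i : ℕ)) • (b : AlgebraicClosure (v.adicCompletion ℚ))) ≠ 0 := by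
    by_contra hall
    push Not at hall
    have hsum : (∑ i : Fin (2 ^ R), c i • ((χ i : M →* AlgebraicClosure (v.adicCompletion ℚ)) :
        M → AlgebraicClosure (v.adicCompletion ℚ))) = 0 := by
      funext x
      rw [Finset.sum_apply, Pi.zero_apply]
      simp only [Pi.smul_apply, smul_eq_mul]
      exact hall x
    have h0 := Fintype.linearIndependent_iff.mp hli (fun i ↦ c i) hsum ⟨0, hR0⟩
    exact one_ne_zero (hc0 ▸ h0)
  -- the resolvent `θ` and the identity `u · gθ = θ`
  set θ : AlgebraicClosure (v.adicCompletion ℚ) :=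
    ∑ i ∈ Finset.range (2 ^ R), c i * (g ^ i) • (b : AlgebraicClosure (v.adicCompletion ℚ)) with hθ
  have hθb : (∑ i : Fin (2 ^ R), c i * (g ^ (i : ℕ)) • (b : AlgebraicClosure (v.adicCompletion ℚ))) = θ :=
    Fin.sum_univ_eq_sum_range (fun i ↦ c i * (g ^ i) • (b : AlgebraicClosure (v.adicCompletion ℚ))) (2 ^ R)
  have hθ0 : θ ≠ 0 := hθb ▸ hb
  have hshift : ∀ i : ℕ, u * (g • c i) = c (i + 1) := by
    intro i
    change u * (g • ∏ j ∈ Finset.range i, (g ^ j) • u) = ∏ j ∈ Finset.range (i + 1), (g ^ j) • u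
    rw [Finset.prod_range_succ', pow_zero, one_smul, Finset.smul_prod', mul_comm]
    congr 1
    exact Finset.prod_congr rfl fun j _ ↦ by rw [← mul_smul, ← pow_succ']
  have hgb : (g ^ 2 ^ R) • (b : AlgebraicClosure (v.adicCompletion ℚ)) = b := hgRM _ b.2
  have hkey : u * (g • θ) = θ := by
    have h1 : u * (g • θ) = ∑ i ∈ Finset.range (2 ^ R), c (i + 1) * (g ^ (i + 1)) •
        (b : AlgebraicClosure (v.adicCompletion ℚ)) := by
      rw [hθ, Finset.smul_sum, Finset.mul_sum]
      refine Finset.sum_congr rfl fun i _ ↦ ?_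
      rw [smul_mul', ← mul_assoc, hshift i, ← mul_smul, ← pow_succ']
    have h2 := Finset.sum_range_succ' (fun i ↦ c i * (g ^ i) • (b : AlgebraicClosure (v.adicCompletion ℚ))) (2 ^ R)
    have h3 := Finset.sum_range_succ (fun i ↦ c i * (g ^ i) • (b : AlgebraicClosure (v.adicCompletion ℚ))) (2 ^ R)
    rw [h1]
    simp only [pow_zero, one_smul, hc0, one_mul] at h2
    rw [h3, hcN, hgb, one_mul, ← hθ] at h2
    linear_combination -h2
  -- `y = θ⁻¹`
  have hgθ0 : g • θ ≠ 0 := by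
    intro h0
    rw [h0, mul_zero] at hkey
    exact hθ0 hkey.symm
  have hθM : θ ∈ M := by
    rw [hθ]
    refine sum_mem fun i _ ↦ mul_mem ?_ (hstab _ _ b.2)
    exact prod_mem fun j _ ↦ hstab _ _ huM
  refine ⟨θ⁻¹, inv_ne_zero hθ0, fun h hh hht ↦ ?_, ?_⟩
  · rw [smul_inv'', (hmemM θ).mp hθM h hh hht]
  · rw [smul_inv'', eq_div_iff (inv_ne_zero hθ0)]
    field_simp
    linear_combination hkey

end Summit.BirchSwinnertonDyer.BirchSwinnertonDyer.Theorems.MultTowerNS2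

end
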